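import Mathlib.LinearAlgebra.PiTensorProduct.Basic
import Mathlib.LinearAlgebra.Eigenspace.Basic
import Mathlib.Algebra.Group.Pi.Lemmas

/-!
# Single-slot operators on a tensor product of a family of modules

Topic `LinearAlgebra/TensorSlot`.  For a family of `R`-modules `s : ι → Type*` over a commutative semiring and
an index `i`, an endomorphism `f` of the factor `s i` acts on the tensor product `⨂[R] j, s j` "in slot `i`,
identity in every other slot":

  `slot i f (⨂ₜ x) = ⨂ₜ (update x i (f (x i)))`,   i.e.  `slot i f = 1 ⊗ ⋯ ⊗ f ⊗ ⋯ ⊗ 1`.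

Mathlib has the simultaneous functoriality `PiTensorProduct.map : (Π j, s j →ₗ t j) → (⨂ s →ₗ ⨂ t)` with
`map_tprod`, `map_mul`, `mapMonoidHom`, and the one-slot linearity `map_update_add` / `map_update_smul`
(`PiTensorProduct.mapMultilinear`), but no name for the single-slot operator; this file supplies it as an
`R`-algebra homomorphism

* `slot i : Module.End R (s i) →ₐ[R] Module.End R (⨂[R] j, s j)`, `slot i f = PiTensorProduct.map (Pi.mulSingle i f)`
  (`slot_apply`), with `slot_tprod`, `slot_one`/`slot_mul` (for free), different slots commute
  (`commute_slot_slot`), `map f = slot i (f i) * map (update f i 1)` (`map_eq_slot_mul_map_update`);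
* eigenvectors: `slot_tprod_of_eigen` (a pure tensor with an `f`-eigenvector in slot `i` is a `slot i f`-eigenvector),
  `map_tprod_of_eigen` (a pure tensor of eigenvectors is a joint eigenvector of `map f` with the PRODUCT eigenvalue),
  `tprod_update_mem_eigenspace`, and the transport of diagonalisability `iSup_eigenspace_slot_eq_top`
  (if `s i` is the sum of the eigenspaces of `f`, then `⨂ s` is the sum of the eigenspaces of `slot i f`).

This is the algebra behind "`U(𝔤₁ ⊕ ⋯ ⊕ 𝔤ₙ) = U(𝔤₁) ⊗ ⋯ ⊗ U(𝔤ₙ)` acts factorwise on `V₁ ⊗ ⋯ ⊗ Vₙ`" and "a tensor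
product of weight vectors is a weight vector of the product weight" [folklore] (e.g. N. Bourbaki, *Algèbre*,
Ch. II §3 no. 2–5, the functoriality of `⨂`; the outer tensor product of representations).  Everything is proved,
Mathlib only; the companion file `CyclicVector` treats cyclic vectors.

## Provenance

Reproduced for the tree under the LEAN-IN-TREE rule (2026-08-18) from the pub-hodgecm cell's package files
`HodgeCM/PerL34/ArchCFock.lean` §1 (`Fock.slot`, `slot_tprod`, `map_tprod_eq_prod_smul`; DAG-node prover #12
lineage, seat pv12-g2, gate run 21) and `HodgeCM/PerL34/ArchAFock.lean` §2 (`slotAct`, `tprod_update_mem_weightSpace`,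
`iSup_weightSpace_slotAct_eq_top`; seat pv12-g6, gate run 27), generalised from `ℂ` to a commutative semiring,
from a bare linear map to an algebra homomorphism, and from `U(1)`-weight spaces to Mathlib's `Module.End.eigenspace`.
-/

set_option autoImplicit false

open Function PiTensorProduct
open scoped TensorProduct

namespace Literature.LinearAlgebra.TensorSlot

section CommSemiring

variable {ι : Type*} [DecidableEq ι] {R : Type*} [CommSemiring R]
variable {s : ι → Type*} [∀ i, AddCommMonoid (s i)] [∀ i, Module R (s i)]

/-- The single-slot operator as a LINEAR map `Module.End R (s i) →ₗ[R] Module.End R (⨂[R] j, s j)`: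
`f ↦ PiTensorProduct.map (update 1 i f)` (Mathlib's `mapMultilinear` with all other arguments frozen at `1`).
[folklore] -/
noncomputable def slotₗ (i : ι) : Module.End R (s i) →ₗ[R] Module.End R (⨂[R] j, s j) :=
  (PiTensorProduct.mapMultilinear R s s).toLinearMap 1 i

/-- `slotₗ i f = map (Pi.mulSingle i f)` (`Pi.mulSingle i f = update 1 i f`). [folklore] -/
theorem slotₗ_apply (i : ι) (f : Module.End R (s i)) :
    slotₗ i f = PiTensorProduct.map (Pi.mulSingle i f) :=
  rfl

/-- **The single-slot operator** `slot i : Module.End R (s i) →ₐ[R] Module.End R (⨂[R] j, s j)`,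
`f ↦ 1 ⊗ ⋯ ⊗ f ⊗ ⋯ ⊗ 1` (slot `i`), as an `R`-algebra homomorphism: `slot i 1 = 1`,
`slot i (f * g) = slot i f * slot i g`, `slot i (f + g) = slot i f + slot i g`, `slot i (c • f) = c • slot i f`.
[folklore] -/
noncomputable def slot (i : ι) : Module.End R (s i) →ₐ[R] Module.End R (⨂[R] j, s j) :=
  AlgHom.ofLinearMap (slotₗ i)
    (by rw [slotₗ_apply, Pi.mulSingle_one]; exact PiTensorProduct.map_one)
    (fun f g => by
      rw [slotₗ_apply, slotₗ_apply, slotₗ_apply, Pi.mulSingle_mul]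
      exact PiTensorProduct.map_mul _ _)

/-- `slot i f = PiTensorProduct.map (Pi.mulSingle i f) = map (update 1 i f)`. [folklore] -/
theorem slot_apply (i : ι) (f : Module.End R (s i)) : slot i f = PiTensorProduct.map (Pi.mulSingle i f) :=
  rfl

/-- **Action on pure tensors:** `slot i f (⨂ₜ x) = ⨂ₜ (update x i (f (x i)))`. [folklore] -/
theorem slot_tprod (i : ι) (f : Module.End R (s i)) (x : Π j, s j) :
    slot i f (tprod R x) = tprod R (update x i (f (x i))) := by
  rw [slot_apply, PiTensorProduct.map_tprod]
  congr 1
  funext j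
  by_cases h : j = i
  · subst h
    rw [Pi.mulSingle_eq_same, update_self]
  · rw [Pi.mulSingle_eq_of_ne h, update_of_ne h, Module.End.one_apply]

/-- `slot i 1 = 1`. [folklore] -/
theorem slot_one (i : ι) : slot i (1 : Module.End R (s i)) = 1 :=
  map_one (slot i)

/-- `slot i (f * g) = slot i f * slot i g` (composition in one slot). [folklore] -/
theorem slot_mul (i : ι) (f g : Module.End R (s i)) : slot i (f * g) = slot i f * slot i g :=
  map_mul (slot i) f g

/-- **Different slots commute:** `slot i f * slot j g = slot j g * slot i f` for `i ≠ j`. [folklore] -/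
theorem commute_slot_slot {i j : ι} (hij : i ≠ j) (f : Module.End R (s i)) (g : Module.End R (s j)) :
    Commute (slot i f) (slot j g) := by
  show slot i f * slot j g = slot j g * slot i f
  rw [slot_apply, slot_apply, ← PiTensorProduct.map_mul, ← PiTensorProduct.map_mul]
  congr 1
  funext k
  simpa only [Pi.mul_apply] using congrFun (Pi.mulSingle_commute (f := fun l => Module.End R (s l)) hij f g).eq k

/-- Operators in the same slot commute when the factor operators do. [folklore] -/
theorem commute_slot_slot_same (i : ι) {f g : Module.End R (s i)} (h : Commute f g) :
    Commute (slot i f) (slot i g) := by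
  show slot i f * slot i g = slot i g * slot i f
  rw [← slot_mul, ← slot_mul, h.eq]

/-- Two slot operators applied to a pure tensor, `i ≠ j`: both factors are updated. [folklore] -/
theorem slot_slot_tprod_of_ne {i j : ι} (hij : i ≠ j) (f : Module.End R (s i)) (g : Module.End R (s j))
    (x : Π k, s k) :
    slot i f (slot j g (tprod R x)) = tprod R (update (update x j (g (x j))) i (f (x i))) := by
  rw [slot_tprod, slot_tprod, update_of_ne hij]

/-- **Factoring one slot off `PiTensorProduct.map`:** `map f = slot i (f i) * map (update f i 1)`. [folklore] -/
theorem map_eq_slot_mul_map_update (f : Π j, Module.End R (s j)) (i : ι) :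
    PiTensorProduct.map f = slot i (f i) * PiTensorProduct.map (update f i 1) := by
  rw [slot_apply, ← PiTensorProduct.map_mul]
  congr 1
  funext j
  by_cases h : j = i
  · subst h
    rw [Pi.mulSingle_eq_same, update_self, mul_one]
  · rw [Pi.mulSingle_eq_of_ne h, update_of_ne h, one_mul]

/-- `PiTensorProduct.map f` commutes with every `slot i (f i)`. [folklore] -/
theorem commute_map_slot (f : Π j, Module.End R (s j)) (i : ι) :
    Commute (PiTensorProduct.map f) (slot i (f i)) := by
  show PiTensorProduct.map f * slot i (f i) = slot i (f i) * PiTensorProduct.map f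
  rw [slot_apply, ← PiTensorProduct.map_mul, ← PiTensorProduct.map_mul]
  congr 1
  funext k
  by_cases hk : k = i
  · subst hk
    rw [Pi.mulSingle_eq_same]
  · rw [Pi.mulSingle_eq_of_ne hk, mul_one, one_mul]

/-! ### Eigenvectors -/

/-- **A pure tensor with an `f`-eigenvector in slot `i` is a `slot i f`-eigenvector** with the same
eigenvalue: `f (x i) = c • x i ⇒ slot i f (⨂ₜ x) = c • ⨂ₜ x`. [folklore] -/
theorem slot_tprod_of_eigen (i : ι) (f : Module.End R (s i)) (x : Π j, s j) {c : R} (h : f (x i) = c • x i) :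
    slot i f (tprod R x) = c • tprod R x := by
  rw [slot_tprod, h, MultilinearMap.map_update_smul, update_eq_self]

omit [DecidableEq ι] in
/-- **A pure tensor of eigenvectors is a joint eigenvector with the product eigenvalue:**
`(∀ i, f i (x i) = c i • x i) ⇒ map f (⨂ₜ x) = (∏ i, c i) • ⨂ₜ x` ("the weight of a tensor product of weight
vectors is the sum of the weights", written multiplicatively). [folklore] -/
theorem map_tprod_of_eigen [Fintype ι] (f : Π i, Module.End R (s i)) (c : ι → R) (x : Π i, s i)
    (h : ∀ i, f i (x i) = c i • x i) :
    PiTensorProduct.map f (tprod R x) = (∏ i, c i) • tprod R x := by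
  rw [PiTensorProduct.map_tprod]
  have hx : (fun i => f i (x i)) = fun i => c i • x i := funext h
  rw [hx, MultilinearMap.map_smul_univ]

omit [DecidableEq ι] in
/-- The same for a family of operators depending on a parameter (e.g. a torus `T = Π i, T i` acting
factorwise): if `ω i t` acts on `x i` by the scalar `χ i t`, then `map (fun i => ω i (t i))` acts on `⨂ₜ x` by
`∏ i, χ i (t i)`. [folklore] -/
theorem map_tprod_of_eigen_family [Fintype ι] {T : ι → Type*} (ω : ∀ i, T i → Module.End R (s i))
    (χ : ∀ i, T i → R) (x : Π i, s i) (h : ∀ i (t : T i), ω i t (x i) = χ i t • x i) (t : Π i, T i) :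
    PiTensorProduct.map (fun i => ω i (t i)) (tprod R x) = (∏ i, χ i (t i)) • tprod R x :=
  map_tprod_of_eigen _ _ x fun i => h i (t i)

end CommSemiring

/-! ### Eigenspaces (commutative ring of scalars, as Mathlib's `Module.End.eigenspace` requires) -/

section CommRing

variable {ι : Type*} [DecidableEq ι] {R : Type*} [CommRing R]
variable {s : ι → Type*} [∀ i, AddCommGroup (s i)] [∀ i, Module R (s i)]

/-- A pure tensor with slot `i` in the `μ`-eigenspace of `f` lies in the `μ`-eigenspace of `slot i f`.
[folklore] -/
theorem tprod_update_mem_eigenspace (i : ι) (f : Module.End R (s i)) (m : Π j, s j) {μ : R} {x : s i}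
    (hx : x ∈ f.eigenspace μ) : tprod R (update m i x) ∈ (slot i f).eigenspace μ := by
  rw [Module.End.mem_eigenspace_iff] at hx ⊢
  rw [slot_tprod, update_self, update_idem, hx, MultilinearMap.map_update_smul]

/-- **Transport of diagonalisability to a slot.**  If the factor `s i` is the sum of the eigenspaces of `f`,
then `⨂[R] j, s j` is the sum of the eigenspaces of `slot i f` (every pure tensor is a finite sum of pure
tensors with an eigenvector in slot `i`, and pure tensors span). [folklore] -/
theorem iSup_eigenspace_slot_eq_top (i : ι) (f : Module.End R (s i)) (h : ⨆ μ : R, f.eigenspace μ = ⊤) :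
    ⨆ μ : R, (slot i f).eigenspace μ = ⊤ := by
  have key : ∀ m : Π j, s j, tprod R m ∈ ⨆ μ : R, (slot i f).eigenspace μ := by
    intro m
    -- vary slot `i` linearly, all other slots of `m` fixed
    let L : s i →ₗ[R] ⨂[R] j, s j := (tprod R).toLinearMap m i
    have hL : ∀ x, L x = tprod R (update m i x) := fun _ => rfl
    have hle : (⊤ : Submodule R (s i)) ≤ (⨆ μ : R, (slot i f).eigenspace μ).comap L := by
      rw [← h, iSup_le_iff]
      intro μ x hx
      rw [Submodule.mem_comap, hL]
      exact Submodule.mem_iSup_of_mem μ (tprod_update_mem_eigenspace i f m hx)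
    have hm : L (m i) ∈ ⨆ μ : R, (slot i f).eigenspace μ := hle (Submodule.mem_top : m i ∈ ⊤)
    rwa [hL, update_eq_self] at hm
  rw [eq_top_iff, ← PiTensorProduct.span_tprod_eq_top, Submodule.span_le]
  rintro _ ⟨m, rfl⟩
  exact key m

end CommRing

end Literature.LinearAlgebra.TensorSlot
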